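import Literature.NumberTheory.EllipticCurves.Disegni2017.ChiLineGrossZagier
import Literature.NumberTheory.EllipticCurves.CanonicalPAdicHeightCyc
import Literature.FieldTheory.Galois.QuadraticExtensionAutomorphisms
import HarnessLib

/-!
# Disegni 2017, THEOREM B (with Theorem A on the line and Yuan–Zhang–Zhang (1.1.3)) AT A QUADRATIC
# BASE-CHANGE CHARACTER `χ = ψ ∘ N_{K/ℚ}`, FOR THE CANONICAL CYCLOTOMIC HEIGHT DATUM — ONE named fact

Topic `Literature/NumberTheory/EllipticCurves`, cluster `Disegni2017` (namespace = path). Companion of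
`ChiLineRankinSelberg.lean` (Theorem A on the line through `χ`: the named fact `thmA_chiLine`, the factor
`Z°_p`, `IsNotExceptionalAt`, `baseChangeDirichlet`), `ChiLineGrossZagier.lean` (Theorem B ÷ YZZ (1.1.3)
at `χ` as PREDICATES: `chiHeightPairing`, `chiPAdicPairing`, `ChiArchRatioClause`, `ChiPAdicRatioClause`,
`ChiLineGrossZagierClauses`, and the vacuity discussion) and of the receptacle
`CanonicalPAdicHeightCyc.lean` (`PAdicHeightDataK.IsCanonicalCyc`, `exists_isCanonicalCyc`,
`PAdicHeightDataK.smul`). Written by the typer seat `bsd-print-cf2-ty2` (g50) on the planner's SUMMON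
`wake/SUMMON-bsd-print-cf2-ty2-20260831T001723Z.md` (T1) — the ENTRY TICKET of the support item
stmt-BirchSwinnertonDyer-27146 `PrintCf2.SplitBadTwoDisegniGZPairOfFacts` of route A (road (C)
`disegni-pair-two` of the crux `PrintCf2.SplitBadTwoRankOneOfFacts`). ONE named fact (+1), nothing
proved about it; two proved repackagings. BSD is not proved by any of this.

## The source, verbatim (arXiv:1510.02114v3 = Compos. Math. 153 (2017), held text
## `paper:arxiv-1510.02114`, `pN Lk` = materialised page/line; Errata = J. Inst. Math. Jussieu 22
## (2023) §6 = `paper:arxiv-1907.13040` p0021)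

[p7 L30–38] «We assume this [potential ordinarity] to be the case for all `v ∣ p`. One then has a
canonical `p`-adic height pairing `⟨ , ⟩ : A(F̄)_ℚ ⊗_M A^∨(F̄)_ℚ → Γ_F ⊗̂ L` (1.3.1) … Its equivariance
properties under the action of `𝒢_F` allow to deduce from it pairings `⟨ , ⟩ : A(χ) ⊗_{L(χ)} A^∨(χ⁻¹)
→ Γ_F ⊗̂ L(χ)` (1.3.2) for any character `χ ∈ 𝒴^{l.c.}_L`.» [p7 L48] «If `χ` is not exceptional …,
then (1.3.2) is known to coincide with the norm-adapted height pairings à la Schneider, by [Nekovář],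
and with the Mazur–Tate height pairings, by [Iovita–Werner].» [p7 L50] Def. 4 (not exceptional:
`Z_w(χ_w) ≠ 0` for all `w ∣ p`). [p8 L9–18] «Let `χ ∈ 𝒴^{l.c., an}` be a character such that
`ε(A_E, χ) = −1` … **Theorem 2 (= Theorem B).** Suppose that for all `v ∣ p`, `A/F_v` has potentially
`𝔭`-ordinary good or semistable reduction, `E_v/F_v` is split, and `χ` is not exceptional. Then for all
`f₁ ∈ π_A`, `f₂ ∈ π_{A^∨}` we have `⟨P(f₁,χ), P^∨(f₂,χ⁻¹)⟩ = (c_E/2)·∏_{v∣p} Z°_v(χ_v)⁻¹ ·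
d_F L_{p,α}(σ_{A,E})(χ) · Q(f₁,f₂,χ)` in `𝒩*_{𝒴/𝒴′}|_χ ≅ Γ_F ⊗̂ L(χ)`.» [p4 L24–47] (1.1.2)–(1.1.4)
(Tunnell–Saito, the Néron–Tate case = Yuan–Zhang–Zhang: `𝓛 = (c_E/2)·π^{2[F:ℚ]}|D_F|^{1/2}
L′(1/2, σ_{A,E}⊗χ)/(2L(1,η)L(1,σ_A,ad))`, `c_E ∈ ℚ^×`). ERRATA (p0021 L14–18): «Theorem B. The constant
factor should be `c_E` and not `c_E/2` … the direct analogue of `s ↦ L(1/2+s, σ_E, χ)` is `χ_F ↦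
L_p(σ_E)(χ·χ_F∘q)`, whose derivative at `χ_F = 𝟙` is twice our `d_F L_p(σ_E)(χ)`.» [p28 L97–101]
(4.1.7) `ℓ_w := [F′:F]⁻¹ ℓ_v ∘ N_{F′_w/F_v}` (the absolute normalisation of the pairing on `A(F̄)`).

## What is typed, and why in this shape

THE SPECIAL CASE (the one road (C) needs; `-- TODO(general form)` below): `F = ℚ`; `E = K` imaginary
quadratic with `p𝒪_K = 𝔭𝔭′` SPLIT («`E_v/F_v` is split»); `A = E/ℚ` an elliptic curve with globally
minimal model `W`, GOOD ORDINARY at `p` («potentially `𝔭`-ordinary good»; unit character unramified,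
`a = ι(α)`, `α = unitRoot W p` — the `E/ℚ` reading of `thmA_chiLine`'s binders, PROVED there as
`heckePolynomial_clause_of_unitRoot`); `f` the newform of `E` (`IsNewformOf W f`); the character
`χ = ψ ∘ N_{K/ℚ}` (`baseChangeDirichlet K ψ`) for a QUADRATIC Dirichlet character `ψ` — typed through the
squarefree-class `d` it cuts out: `ψ(ℓ) = (d/ℓ)` for every odd prime `ℓ ∤ m` (this pins `ψ` as the
Kronecker character of `ℚ(√d)`, by Chebotarev) — so that `χ ∈ 𝒴′^{l.c.}` automatically
(`χ|_{𝔸_ℚ^×} = ψ² = 1`) and the abelian extension of `K` cut out by `χ` is `H = K(√d)`: the binders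
`[H:K] = 2`, `t ∈ H`, `t² = d`, `t ∉ K`, `τ ∈ Aut(H/ℚ)` fixing `K` with `τt = −t`, `G = {1, τ}`
(= `Gal(H/K)`, AS A SUBGROUP of `Aut(H/ℚ)`, the parameter of `chiHeightPairing`/`chiPAdicPairing`) and
`χ(τ) = −1` (the sign character — THE Galois character corresponding to `ψ∘N` under reciprocity in
either normalisation, values `±1`). This is the DICTIONARY «Galois character on `G` ↔ Hecke character
`χ_H`» that `ChiLineGrossZagierClauses` leaves to its consumer, made explicit in the only case where it is
elementary; a general finite-order `χ` needs the tree's `charHecke` dictionary over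
`IntermediateField K (AlgebraicClosure K)` (`-- TODO(general form)`).

THE SIGN. «`ε(A_E, χ) = −1`» is typed, in the currency the clauses already use, as: EVERY entire
continuation `Λ` of `rankinSelbergEulerProductHecke f χ` (Disegni's `L(s − 1/2, σ_{A,K} ⊗ χ)`, currency
note (S5) of `ChiLineRankinSelberg.lean`) has `Λ(1) = 0` and `Λ′(1) ≠ 0` — a SIMPLE zero at the centre.
An odd order of vanishing forces the sign `−1` (functional equation `s ↔ 2 − s`), so this binder IMPLIES
the printed hypothesis; it is the analytic-rank-one case of Theorem B (the case in which the ratio form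
has content: `q ≠ 0` and `Λ′(1) ≠ 0` pin the `χ`-isotypic heights), and the only case road (C) meets
(`Λ = L(W,s)·L(W′,s)` up to shift for the pair of twists, ranks `1 + 0`). `-- TODO(general form):
-- ε(A_E,χ) = −1 with ord_{s=1} ≥ 3 (typed e.g. as «odd analytic order»).`

THE TREE-CURRENCY BINDER of `thmA_chiLine` («`χ` unramified above every `ℓ` with `ℓ² ∣ N`», because the
tree's Euler product drops jointly ramified factors) reads, for `χ = ψ∘N` (ramified exactly above the
primes of `m = cond ψ`): `ℓ ∣ m ⇒ ℓ² ∤ N`. `p² ∤ N` holds by good reduction at `p`.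

THE HEIGHT DATUM AND THE CONSTANT `c`. Print asserts the formula for THE canonical pairing (1.3.1)
composed with `ℓ = log_p ∘ χ_cyc` (the direction of the cyclotomic derivative in `ChiPAdicRatioClause`),
absolutely normalised by (4.1.7), which «coincides with … Schneider … and with the Mazur–Tate height
pairings» [p7 L48], i.e. — for `E/ℚ` good ordinary at `p`, on `E(H)` — with the pairing pinned by the
tree's receptacle `PAdicHeightDataK.IsCanonicalCyc` (Mazur–Stein–Tate's sigma formula over `H`,
sigma-squared form, absolute normalisation) UP TO A UNIVERSAL NORMALISING CONSTANT `c ∈ ℚ^×` (sign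
conventions of the reciprocity map / of `−ℓ_v(s_v[E_v])`, the `(O)`- versus `2(O)`-normalisation shared
with the Néron–Tate side of (1.1.3), Stein–Wuthrich's `2 log_p(e/σ)`): the fact says `∃ c ≠ 0`,
quantified BEFORE everything but `p`, such that the clauses hold for `c • DH` whenever `DH` is canonical.
This `∃` is honest (the typer does not adjudicate between authors' normalisations) and costs the consumer
nothing: road (C) reads the `2`-adic valuation of a ratio that is universal per line anyway (`ρ` of
stmt-27146 becomes `v₂(c)`), and the PIN to the minus-twist receptacle has factor one
(`isCanonicalCyc_pairing_eq_minusTwist`), so `r = c`.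

VACUITY DISCIPLINE (module docstring of `ChiLineGrossZagier.lean`): the conclusion is the `∀ DH,
IsCanonicalCyc DH → …`-form; `IsCanonicalCyc` pins `⟨P,P⟩` on admissible points, the existence of such a
`DH` (with `Aut(H/ℚ)`-invariance) is the separate fact `exists_isCanonicalCyc`, and the repackaging
`exists_datum` below hands the consumer `∃ DH₀ canonical, (c•DH₀) G-invariant ∧ clauses(c•DH₀)`.

## Theorem B's printed hypotheses ↔ binders (R2-G44: every printed hypothesis verbatim)

«for all `v ∣ p`, `A/F_v` has potentially `𝔭`-ordinary good or semistable reduction» ↔ `IsOrdinaryAt W p`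
(good ordinary; `-- TODO(general form): multiplicative at p, a = a_p = ±1; potentially ordinary`);
«`E_v/F_v` is split» ↔ `primesOver … ncard = 2`, `𝔭 ≠ 𝔭′` above `p`; «`χ` is not exceptional» ↔
`IsNotExceptionalAt a χ 𝔭 ∧ IsNotExceptionalAt a χ 𝔭′` (for `ψ∘N` RAMIFIED above `2` — road (C) — the
tree PROVES it: `ChiLineRamifiedNotExceptionalProofs.lean`); «`χ ∈ 𝒴^{l.c., an}`, `ε(A_E,χ) = −1`» ↔
`ψ` quadratic (so `ω_A·χ|_{𝔸^{∞,×}} = ψ² = 1`) + the simple-zero binder; «`A` modular, parametrised by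
`X(𝔹)`» ↔ `IsNewformOf W f` (`𝔹` is determined by (1.1.1) and needs no carrier in ratio form); the
test-vector clause `q ≠ 0` and the constants `c_E`, `Z°_p`, `d_F ↦ ½·d/ds` are inside
`ChiLineGrossZagierClauses` (its docstring). Theorem A's hypotheses (same `K, 𝔭, 𝔭′, f, a`) are those of
`thmA_chiLine`; (1.1.3)'s are Theorem B's minus the `p`-adic ones.

## What is NOT here

No proof (`_holds`: size XL — Disegni's theorem); no general `χ` (dictionary), no `A` of `GL₂`-type with
`dim > 1` (no point/height carrier in the tree), no multiplicative `p`, no `p` inert/ramified in `K`, no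
value of `c`. Nothing is asserted; users take `(h : thmB_chi_quadraticBaseChange)`.

## References

* [Disegni2017] D. Disegni, *The p-adic Gross–Zagier formula on Shimura curves*, Compos. Math. 153 (2017)
  1987–2074 = arXiv:1510.02114v3: Thm. B = «Theorem 2» (PDF p. 8 L9–18), §1.3.1 (p. 7 L30–50), Def. 4
  (p. 7 L50), (1.1.2)–(1.1.4) (p. 4 L24–47), Thm. A (p. 6 L31 – p. 7 L14), §4.1.1 (4.1.7) (p. 28 L97–101).
* [Disegni2023ShimuraII] D. Disegni, J. Inst. Math. Jussieu 22 (2023) = arXiv:1907.13040, §6 «Errata to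
  [1]», Theorem B and the remark on `d_F` (materialised p0021 L14–18).
* [YuanZhangZhang2013] X. Yuan, S.-W. Zhang, W. Zhang, Ann. Math. Stud. 184 (2013), Thm. 1.2, §7.1.1.
* [MazurSteinTate2006] §2.7–2.8; [IovitaWerner2003]; [Schneider1982] §1 (the identification of the datum).
* Cell: `wake/SUMMON-bsd-print-cf2-ty2-20260831T001723Z.md` (T1)–(T3); `Theses/PrintCf2.lean` l.1809–1894
  (stmt-27146); `Cruxes/SplitBadTwoRankOneOfFacts/Lines/disegni_pair_two.lean` (`stub_disegniGZ_pair_two`);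
  `bsd-print-cf2-plan/ENTRY-TICKET-disegni-thmB-g24.md` §1–§2; `bsd-print-cf2-ref/PREGRADE-…-v3-ref-g27.md` N2.
-/

noncomputable section

open scoped MatrixGroups ModularForm NumberField Classical
open CongruenceSubgroup NumberField IsDedekindDomain WeierstrassCurve
open Literature.NumberTheory.EllipticCurves.ModularForms
open Literature.NumberTheory.Automorphic

namespace Literature.NumberTheory.EllipticCurves.Disegni2017

/-! ### §1 The named fact -/

/-- **Disegni 2017, Theorem A (on the line) ∧ Theorem B (corrected) ÷ Yuan–Zhang–Zhang (1.1.3), at a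
quadratic base-change character `χ = ψ∘N_{K/ℚ}`, for THE canonical cyclotomic `p`-adic height datum**
(named fact, nothing proved; module docstring for every choice). For: any prime `p` (`p = 2` included)
there is a universal `c ∈ ℚ^×` such that — for every `ι : ℚ̄_p ≅ ℂ`; `K` imaginary quadratic, Galois
over `ℚ`, `p𝒪_K = 𝔭𝔭′` SPLIT; `W/ℚ` globally minimal elliptic, GOOD ORDINARY at `p`, with newform `f`
of level `N` and `a = ι(unitRoot W p)`; `ψ` a Dirichlet character mod `m` with `ψ(ℓ) = (d/ℓ)` at every
odd prime `ℓ ∤ m` (the quadratic character of `ℚ(√d)`), `ℓ ∣ m ⇒ ℓ² ∤ N` (tree-currency binder of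
Theorem A); `χ_H := baseChangeDirichlet K ψ` NOT EXCEPTIONAL at `𝔭` and `𝔭′` [Def. 4]; `L(s, σ_{W,K}⊗χ_H)`
with a SIMPLE zero at the centre (every entire continuation `Λ` of `rankinSelbergEulerProductHecke f χ_H`
has `Λ(1) = 0 ≠ Λ′(1)`; implies «`ε(A_E,χ) = −1`»); `H ⊇ K` a number field with `[H:K] = 2`, `t ∈ H`,
`t² = d`, `t ∉ K` (so `H = K(√d)` is the field cut out by `χ_H`), `τ ∈ Aut(H/ℚ)` fixing `K` with
`τt = −t`, `G = {1, τ} ≤ Aut(H/ℚ)` and `χ : G →* ℂˣ` with `χ(τ) = −1` (the Galois incarnation of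
`χ_H`) — EVERY datum `DH` on `E(H)` which is canonical (`PAdicHeightDataK.IsCanonicalCyc`: the
Schneider / Mazur–Tate cyclotomic height, sigma-squared form, absolutely normalised) satisfies, after
rescaling by `c`, `ChiLineGrossZagierClauses ι K W H f a χ_H 𝔭 𝔭′ G χ (c • DH)`: ONE archimedean constant
`Car > 0` and ONE bounded line function `G_χ` with `ChiLineInterpolation` (Theorem A), and `H`-points
`y₁, y₂`, `q ≠ 0`, `σ₀ = ±1` with `ChiArchRatioClause` ((1.1.3)) and `ChiPAdicRatioClause` (Theorem B,
`c_E` as corrected, `d_F ↦ ½ d/ds`) for the SAME `q`. `c` absorbs the universal normalisation between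
Disegni's (1.3.1)∘(log_p∘χ_cyc) [= Schneider = Mazur–Tate, p. 7 L48] and the receptacle (module
docstring §«The height datum and the constant c»). `-- TODO(general form): general finite-order χ
-- (charHecke dictionary), GL₂-type A, multiplicative p, p non-split in K, ε = −1 of higher odd order.`
[cite: Disegni2017, Theorem B = «Theorem 2» (arXiv v3 PDF p. 8 L9–18), §1.3.1 (1.3.1)–(1.3.2) and p. 7 L48, Def. 4 (p. 7 L50), (1.1.3)–(1.1.4) (p. 4 L24–47), Theorem A (p. 6 L31 – p. 7 L14), (4.1.7) (p. 28 L97–101)]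
[cite: Disegni2023ShimuraII, §6 «Errata to [1]», Theorem B and the remark on d_F (arXiv:1907.13040, materialised p0021 L14–18)]
[cite: YuanZhangZhang2013, Thm. 1.2, §7.1.1] [cite: MazurSteinTate2006, §2.7–2.8 (PDF p. 11)]
[cite: IovitaWerner2003, Introduction (Mazur–Tate = Schneider heights)] -/
def thmB_chi_quadraticBaseChange : Prop :=
  ∀ {p : ℕ} [Fact p.Prime], ∃ c : ℚ, c ≠ 0 ∧
    ∀ (ι : PadicAlgCl p ≃+* ℂ) (K : Type) [Field K] [NumberField K] [IsGalois ℚ K]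
      (𝔭 𝔭' : HeightOneSpectrum (𝓞 K)) (W : WeierstrassCurve ℚ) [W.IsElliptic] [W.IsGloballyMinimal]
      {N : ℕ} [NeZero N] (f : CuspForm (Gamma0 N) 2) {m : ℕ} [NeZero m] (ψ : DirichletCharacter ℂ m)
      (d : ℤ) (H : Type) [Field H] [NumberField H] [Algebra K H] (t : H) (τ : H ≃ₐ[ℚ] H)
      (G : Subgroup (H ≃ₐ[ℚ] H)) (χ : G →* ℂˣ) (hτG : τ ∈ G),
      IsImaginaryQuadratic K → ((Ideal.span {(p : ℤ)}).primesOver (𝓞 K)).ncard = 2 →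
      ((p : ℕ) : 𝓞 K) ∈ 𝔭.asIdeal → ((p : ℕ) : 𝓞 K) ∈ 𝔭'.asIdeal → 𝔭 ≠ 𝔭' →
      IsNewformOf W f → IsOrdinaryAt W p →
      (∀ ℓ : ℕ, ℓ.Prime → ℓ ≠ 2 → ¬ ℓ ∣ m → ψ ℓ = (jacobiSym d ℓ : ℂ)) →
      (∀ ℓ : ℕ, ℓ.Prime → ℓ ∣ m → ¬ ℓ ^ 2 ∣ N) →
      IsNotExceptionalAt (p := p) (ι (((unitRoot W p : ℚ_[p]) : PadicAlgCl p))) (baseChangeDirichlet K ψ) 𝔭 →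
      IsNotExceptionalAt (p := p) (ι (((unitRoot W p : ℚ_[p]) : PadicAlgCl p))) (baseChangeDirichlet K ψ) 𝔭' →
      (∀ Λ : ℂ → ℂ, Differentiable ℂ Λ →
        (∀ s : ℂ, 2 < s.re → Λ s = rankinSelbergEulerProductHecke f (baseChangeDirichlet K ψ) s) →
          Λ 1 = 0 ∧ deriv Λ 1 ≠ 0) →
      Module.finrank K H = 2 → t ^ 2 = algebraMap ℚ H (d : ℚ) → t ∉ Set.range (algebraMap K H) →
      (∀ a : K, τ (algebraMap K H a) = algebraMap K H a) → τ t = -t →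
      (∀ σ : G, (σ : H ≃ₐ[ℚ] H) = 1 ∨ (σ : H ≃ₐ[ℚ] H) = τ) → ((χ ⟨τ, hτG⟩ : ℂˣ) : ℂ) = -1 →
      ∀ DH : PAdicHeightDataK W p H, DH.IsCanonicalCyc →
        ChiLineGrossZagierClauses ι K W H f (ι (((unitRoot W p : ℚ_[p]) : PadicAlgCl p)))
          (baseChangeDirichlet K ψ) 𝔭 𝔭' G χ (DH.smul c)

/-! ### §2 Repackaging for the consumer (proved; the shape of stmt-27146's conclusion) -/

namespace thmB_chi_quadraticBaseChange

/-- **The consumer's shape** — Theorem B at `ψ∘N` COMBINED with the existence of the canonical datum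
(`exists_isCanonicalCyc`): under the binders of the fact plus «`W ⊗ H` globally minimal» (the existence
fact's hypothesis), there are a CANONICAL `DH₀` and the universal `c ≠ 0` such that `DH := c • DH₀` is
invariant under `Aut(H/ℚ)` (in particular under `G`) and satisfies `ChiLineGrossZagierClauses … DH`; the
PIN of `DH` to the minus-twist receptacle is then `isCanonicalCyc_pairing_eq_minusTwist` applied to
`DH₀`, times `c` (`PAdicHeightDataK.smul_pairing`). PROVED from the two facts.
[cite: Disegni2017, Theorem B (arXiv v3 PDF p. 8 L9–18), §1.3.1 (p. 7 L30–38)] [cite: MazurSteinTate2006, §2.7–2.8] -/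
theorem exists_datum (hB : thmB_chi_quadraticBaseChange) (hE : exists_isCanonicalCyc)
    {p : ℕ} [Fact p.Prime] :
    ∃ c : ℚ, c ≠ 0 ∧
      ∀ (ι : PadicAlgCl p ≃+* ℂ) (K : Type) [Field K] [NumberField K] [IsGalois ℚ K]
        (𝔭 𝔭' : HeightOneSpectrum (𝓞 K)) (W : WeierstrassCurve ℚ) [W.IsElliptic] [W.IsGloballyMinimal]
        {N : ℕ} [NeZero N] (f : CuspForm (Gamma0 N) 2) {m : ℕ} [NeZero m] (ψ : DirichletCharacter ℂ m)
        (d : ℤ) (H : Type) [Field H] [NumberField H] [Algebra K H] [(W.baseChange H).IsGloballyMinimal]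
        (t : H) (τ : H ≃ₐ[ℚ] H) (G : Subgroup (H ≃ₐ[ℚ] H)) (χ : G →* ℂˣ) (hτG : τ ∈ G),
        IsImaginaryQuadratic K → ((Ideal.span {(p : ℤ)}).primesOver (𝓞 K)).ncard = 2 →
        ((p : ℕ) : 𝓞 K) ∈ 𝔭.asIdeal → ((p : ℕ) : 𝓞 K) ∈ 𝔭'.asIdeal → 𝔭 ≠ 𝔭' →
        IsNewformOf W f → IsOrdinaryAt W p →
        (∀ ℓ : ℕ, ℓ.Prime → ℓ ≠ 2 → ¬ ℓ ∣ m → ψ ℓ = (jacobiSym d ℓ : ℂ)) →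
        (∀ ℓ : ℕ, ℓ.Prime → ℓ ∣ m → ¬ ℓ ^ 2 ∣ N) →
        IsNotExceptionalAt (p := p) (ι (((unitRoot W p : ℚ_[p]) : PadicAlgCl p))) (baseChangeDirichlet K ψ) 𝔭 →
        IsNotExceptionalAt (p := p) (ι (((unitRoot W p : ℚ_[p]) : PadicAlgCl p))) (baseChangeDirichlet K ψ) 𝔭' →
        (∀ Λ : ℂ → ℂ, Differentiable ℂ Λ →
          (∀ s : ℂ, 2 < s.re → Λ s = rankinSelbergEulerProductHecke f (baseChangeDirichlet K ψ) s) →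
            Λ 1 = 0 ∧ deriv Λ 1 ≠ 0) →
        Module.finrank K H = 2 → t ^ 2 = algebraMap ℚ H (d : ℚ) → t ∉ Set.range (algebraMap K H) →
        (∀ a : K, τ (algebraMap K H a) = algebraMap K H a) → τ t = -t →
        (∀ σ : G, (σ : H ≃ₐ[ℚ] H) = 1 ∨ (σ : H ≃ₐ[ℚ] H) = τ) → ((χ ⟨τ, hτG⟩ : ℂˣ) : ℂ) = -1 →
        ∃ DH₀ : PAdicHeightDataK W p H, DH₀.IsCanonicalCyc ∧
          (∀ (σ : H ≃ₐ[ℚ] H) (a b : (W.baseChange H).toAffine.Point),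
              (DH₀.smul c).pairing (pointGalHom W H σ a) (pointGalHom W H σ b) =
                (DH₀.smul c).pairing a b) ∧
          ChiLineGrossZagierClauses ι K W H f (ι (((unitRoot W p : ℚ_[p]) : PadicAlgCl p)))
            (baseChangeDirichlet K ψ) 𝔭 𝔭' G χ (DH₀.smul c) := by
  obtain ⟨c, hc, h⟩ := hB (p := p)
  refine ⟨c, hc, ?_⟩
  intro ι K _ _ _ 𝔭 𝔭' W _ _ N _ f m _ ψ d H _ _ _ _ t τ G χ hτG hK hsplit h𝔭 h𝔭' hne hf hord hψ hmN
    hexc hexc' hΛ hKH ht2 htK hτK hτt hG hχ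
  obtain ⟨DH₀, hcan, hinv⟩ := hE W p H hord.1 hord.2
  exact ⟨DH₀, hcan, fun σ a b => PAdicHeightDataK.smul_pairing_invariant c (hinv σ) a b,
    h ι K 𝔭 𝔭' W f ψ d H t τ G χ hτG hK hsplit h𝔭 h𝔭' hne hf hord hψ hmN hexc hexc' hΛ hKH ht2 htK
      hτK hτt hG hχ DH₀ hcan⟩

/-- **The clauses alone** (projection). [cite: Disegni2017, Theorem B (arXiv v3 PDF p. 8 L9–18)] -/
theorem clauses (hB : thmB_chi_quadraticBaseChange) {p : ℕ} [Fact p.Prime] :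
    ∃ c : ℚ, c ≠ 0 ∧
      ∀ (ι : PadicAlgCl p ≃+* ℂ) (K : Type) [Field K] [NumberField K] [IsGalois ℚ K]
        (𝔭 𝔭' : HeightOneSpectrum (𝓞 K)) (W : WeierstrassCurve ℚ) [W.IsElliptic] [W.IsGloballyMinimal]
        {N : ℕ} [NeZero N] (f : CuspForm (Gamma0 N) 2) {m : ℕ} [NeZero m] (ψ : DirichletCharacter ℂ m)
        (d : ℤ) (H : Type) [Field H] [NumberField H] [Algebra K H] (t : H) (τ : H ≃ₐ[ℚ] H)
        (G : Subgroup (H ≃ₐ[ℚ] H)) (χ : G →* ℂˣ) (hτG : τ ∈ G),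
        IsImaginaryQuadratic K → ((Ideal.span {(p : ℤ)}).primesOver (𝓞 K)).ncard = 2 →
        ((p : ℕ) : 𝓞 K) ∈ 𝔭.asIdeal → ((p : ℕ) : 𝓞 K) ∈ 𝔭'.asIdeal → 𝔭 ≠ 𝔭' →
        IsNewformOf W f → IsOrdinaryAt W p →
        (∀ ℓ : ℕ, ℓ.Prime → ℓ ≠ 2 → ¬ ℓ ∣ m → ψ ℓ = (jacobiSym d ℓ : ℂ)) →
        (∀ ℓ : ℕ, ℓ.Prime → ℓ ∣ m → ¬ ℓ ^ 2 ∣ N) →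
        IsNotExceptionalAt (p := p) (ι (((unitRoot W p : ℚ_[p]) : PadicAlgCl p))) (baseChangeDirichlet K ψ) 𝔭 →
        IsNotExceptionalAt (p := p) (ι (((unitRoot W p : ℚ_[p]) : PadicAlgCl p))) (baseChangeDirichlet K ψ) 𝔭' →
        (∀ Λ : ℂ → ℂ, Differentiable ℂ Λ →
          (∀ s : ℂ, 2 < s.re → Λ s = rankinSelbergEulerProductHecke f (baseChangeDirichlet K ψ) s) →
            Λ 1 = 0 ∧ deriv Λ 1 ≠ 0) →
        Module.finrank K H = 2 → t ^ 2 = algebraMap ℚ H (d : ℚ) → t ∉ Set.range (algebraMap K H) →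
        (∀ a : K, τ (algebraMap K H a) = algebraMap K H a) → τ t = -t →
        (∀ σ : G, (σ : H ≃ₐ[ℚ] H) = 1 ∨ (σ : H ≃ₐ[ℚ] H) = τ) → ((χ ⟨τ, hτG⟩ : ℂˣ) : ℂ) = -1 →
        ∀ DH : PAdicHeightDataK W p H, DH.IsCanonicalCyc →
          ChiLineGrossZagierClauses ι K W H f (ι (((unitRoot W p : ℚ_[p]) : PadicAlgCl p)))
            (baseChangeDirichlet K ψ) 𝔭 𝔭' G χ (DH.smul c) :=
  hB (p := p)

end thmB_chi_quadraticBaseChange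

/-! ### §3 (append, ty2 g50) The PINNED datum — the three facts composed into the shape of stmt-27146 -/

namespace thmB_chi_quadraticBaseChange

/-- **The pinned Disegni datum** — `thmB_chi_quadraticBaseChange` ∧ `exists_isCanonicalCyc` ∧
`isCanonicalCyc_pairing_eq_minusTwist` COMPOSED (PROVED from the three named facts, nothing else):
for every frame of the fact with «`W ⊗ H` globally minimal» there is a datum `DH` on `E(H)` (namely
`c • DH₀`, `DH₀` THE canonical cyclotomic datum, `c ∈ ℚ^×` the universal constant of the fact) which is
`Aut(H/ℚ)`-invariant, satisfies `ChiLineGrossZagierClauses ι K W H f a (ψ∘N) 𝔭 𝔭′ G χ DH`, and whose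
value on every `H`-point `P′` of `W` with `x(P′) = X/d` is `c ·` the value of ANY canonical minus-twist
`ℚ`-datum `Dc` of `W^{(d)}` on `P = (X, Y)` — i.e. the conclusion of the route item
`PrintCf2.SplitBadTwoDisegniGZPairOfFacts` (stmt-27146) for one line, with `r = c`, `ρ = v_p(c)`
universal, up to the consumer's identification `x(twistPointEquivOver … (incl P)) = X/d`.
[cite: Disegni2017, Theorem B (arXiv v3 PDF p. 8 L9–18), (4.1.7) (p. 28 L97–101)]
[cite: MazurSteinTate2006, §2.7–2.8 (PDF p. 11)] -/
theorem exists_datum_pinned (hB : thmB_chi_quadraticBaseChange) (hE : exists_isCanonicalCyc)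
    (hPin : isCanonicalCyc_pairing_eq_minusTwist) {p : ℕ} [Fact p.Prime] :
    ∃ c : ℚ, c ≠ 0 ∧
      ∀ (ι : PadicAlgCl p ≃+* ℂ) (K : Type) [Field K] [NumberField K] [IsGalois ℚ K]
        (𝔭 𝔭' : HeightOneSpectrum (𝓞 K)) (W : WeierstrassCurve ℚ) [W.IsElliptic] [W.IsGloballyMinimal]
        {N : ℕ} [NeZero N] (f : CuspForm (Gamma0 N) 2) {m : ℕ} [NeZero m] (ψ : DirichletCharacter ℂ m)
        (d : ℤ) [(W.quadraticTwist (d : ℚ)).IsElliptic] (H : Type) [Field H] [NumberField H] [Algebra K H]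
        [(W.baseChange H).IsGloballyMinimal]
        (t : H) (τ : H ≃ₐ[ℚ] H) (G : Subgroup (H ≃ₐ[ℚ] H)) (χ : G →* ℂˣ) (hτG : τ ∈ G),
        IsImaginaryQuadratic K → ((Ideal.span {(p : ℤ)}).primesOver (𝓞 K)).ncard = 2 →
        ((p : ℕ) : 𝓞 K) ∈ 𝔭.asIdeal → ((p : ℕ) : 𝓞 K) ∈ 𝔭'.asIdeal → 𝔭 ≠ 𝔭' →
        IsNewformOf W f → IsOrdinaryAt W p →
        (∀ ℓ : ℕ, ℓ.Prime → ℓ ≠ 2 → ¬ ℓ ∣ m → ψ ℓ = (jacobiSym d ℓ : ℂ)) →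
        (∀ ℓ : ℕ, ℓ.Prime → ℓ ∣ m → ¬ ℓ ^ 2 ∣ N) →
        IsNotExceptionalAt (p := p) (ι (((unitRoot W p : ℚ_[p]) : PadicAlgCl p))) (baseChangeDirichlet K ψ) 𝔭 →
        IsNotExceptionalAt (p := p) (ι (((unitRoot W p : ℚ_[p]) : PadicAlgCl p))) (baseChangeDirichlet K ψ) 𝔭' →
        (∀ Λ : ℂ → ℂ, Differentiable ℂ Λ →
          (∀ s : ℂ, 2 < s.re → Λ s = rankinSelbergEulerProductHecke f (baseChangeDirichlet K ψ) s) →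
            Λ 1 = 0 ∧ deriv Λ 1 ≠ 0) →
        Module.finrank K H = 2 → t ^ 2 = algebraMap ℚ H (d : ℚ) → t ∉ Set.range (algebraMap K H) →
        (∀ a : K, τ (algebraMap K H a) = algebraMap K H a) → τ t = -t →
        (∀ σ : G, (σ : H ≃ₐ[ℚ] H) = 1 ∨ (σ : H ≃ₐ[ℚ] H) = τ) → ((χ ⟨τ, hτG⟩ : ℂˣ) : ℂ) = -1 →
        ∃ DH : PAdicHeightDataK W p H,
          (∀ (σ : H ≃ₐ[ℚ] H) (a b : (W.baseChange H).toAffine.Point),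
              DH.pairing (pointGalHom W H σ a) (pointGalHom W H σ b) = DH.pairing a b) ∧
          ChiLineGrossZagierClauses ι K W H f (ι (((unitRoot W p : ℚ_[p]) : PadicAlgCl p)))
            (baseChangeDirichlet K ψ) 𝔭 𝔭' G χ DH ∧
          ∀ (Dc : PAdicHeightData (W.quadraticTwist (d : ℚ)) p), Dc.IsCanonicalSqMinusTwist →
            ∀ {X Y : ℚ} (hP : (W.quadraticTwist (d : ℚ)).toAffine.Nonsingular X Y) {x' y' : H}
              (hP' : (W.baseChange H).toAffine.Nonsingular x' y'),
              x' = algebraMap ℚ H (X / (d : ℚ)) →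
                DH.pairing (.some x' y' hP') (.some x' y' hP') =
                  (c : ℚ_[p]) * Dc.pairing (.some X Y hP) (.some X Y hP) := by
  obtain ⟨c, hc, h⟩ := hB (p := p)
  refine ⟨c, hc, ?_⟩
  intro ι K _ _ _ 𝔭 𝔭' W _ _ N _ f m _ ψ d _ H _ _ _ _ t τ G χ hτG hK hsplit h𝔭 h𝔭' hne hf hord hψ hmN
    hexc hexc' hΛ hKH ht2 htK hτK hτt hG hχ
  obtain ⟨DH₀, hcan, hinv⟩ := hE W p H hord.1 hord.2
  refine ⟨DH₀.smul c, fun σ a b => PAdicHeightDataK.smul_pairing_invariant c (hinv σ) a b,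
    h ι K 𝔭 𝔭' W f ψ d H t τ G χ hτG hK hsplit h𝔭 h𝔭' hne hf hord hψ hmN hexc hexc' hΛ hKH ht2 htK
      hτK hτt hG hχ DH₀ hcan, ?_⟩
  intro Dc hDc X Y hP x' y' hP' hx'
  rw [PAdicHeightDataK.smul_pairing, hPin W p (d : ℚ) H DH₀ Dc hcan hDc hP hP' hx']

end thmB_chi_quadraticBaseChange

/-! ### §4 (append, ty2 g50) The same, with «`G` fixes `K`» (the binder of the restated route item
stmt-BirchSwinnertonDyer-27251 = referee C′) in place of «`G = {1, τ}`» -/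

namespace thmB_chi_quadraticBaseChange

/-- **The pinned Disegni datum, `K`-FIXING form of the Galois binder**: as `exists_datum_pinned`, but the
hypothesis on `G ≤ Aut(H/ℚ)` is «every `σ ∈ G` fixes `K` pointwise» (with `τ ∈ G`), which for the
quadratic `H = K(t)` is EQUIVALENT to «every `σ ∈ G` is `1` or `τ`»
(`Literature.FieldTheory.Galois.QuadraticExtension.subgroup_eq_one_or_eq_of_fixing`: a `K`-trivial
automorphism is determined by `σ t = ±t`). This is the binder of the route item
`PrintCf2.SplitBadTwoDisegniGZPairOfFacts` as RESTATED (stmt-BirchSwinnertonDyer-27251, cell referee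
C′: `(∀ (σ : G) (a : K), σ.1 (algebraMap K H a) = algebraMap K H a)`). PROVED from the three named facts.
[cite: Disegni2017, Theorem B (arXiv v3 PDF p. 8 L9–18)] [cite: DummitFoote2004, §14.1 Example (1) after Prop. 2] -/
theorem exists_datum_pinned_of_fixing (hB : thmB_chi_quadraticBaseChange) (hE : exists_isCanonicalCyc)
    (hPin : isCanonicalCyc_pairing_eq_minusTwist) {p : ℕ} [Fact p.Prime] :
    ∃ c : ℚ, c ≠ 0 ∧
      ∀ (ι : PadicAlgCl p ≃+* ℂ) (K : Type) [Field K] [NumberField K] [IsGalois ℚ K]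
        (𝔭 𝔭' : HeightOneSpectrum (𝓞 K)) (W : WeierstrassCurve ℚ) [W.IsElliptic] [W.IsGloballyMinimal]
        {N : ℕ} [NeZero N] (f : CuspForm (Gamma0 N) 2) {m : ℕ} [NeZero m] (ψ : DirichletCharacter ℂ m)
        (d : ℤ) [(W.quadraticTwist (d : ℚ)).IsElliptic] (H : Type) [Field H] [NumberField H] [Algebra K H]
        [(W.baseChange H).IsGloballyMinimal]
        (t : H) (τ : H ≃ₐ[ℚ] H) (G : Subgroup (H ≃ₐ[ℚ] H)) (χ : G →* ℂˣ) (hτG : τ ∈ G),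
        IsImaginaryQuadratic K → ((Ideal.span {(p : ℤ)}).primesOver (𝓞 K)).ncard = 2 →
        ((p : ℕ) : 𝓞 K) ∈ 𝔭.asIdeal → ((p : ℕ) : 𝓞 K) ∈ 𝔭'.asIdeal → 𝔭 ≠ 𝔭' →
        IsNewformOf W f → IsOrdinaryAt W p →
        (∀ ℓ : ℕ, ℓ.Prime → ℓ ≠ 2 → ¬ ℓ ∣ m → ψ ℓ = (jacobiSym d ℓ : ℂ)) →
        (∀ ℓ : ℕ, ℓ.Prime → ℓ ∣ m → ¬ ℓ ^ 2 ∣ N) →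
        IsNotExceptionalAt (p := p) (ι (((unitRoot W p : ℚ_[p]) : PadicAlgCl p))) (baseChangeDirichlet K ψ) 𝔭 →
        IsNotExceptionalAt (p := p) (ι (((unitRoot W p : ℚ_[p]) : PadicAlgCl p))) (baseChangeDirichlet K ψ) 𝔭' →
        (∀ Λ : ℂ → ℂ, Differentiable ℂ Λ →
          (∀ s : ℂ, 2 < s.re → Λ s = rankinSelbergEulerProductHecke f (baseChangeDirichlet K ψ) s) →
            Λ 1 = 0 ∧ deriv Λ 1 ≠ 0) →
        Module.finrank K H = 2 → t ^ 2 = algebraMap ℚ H (d : ℚ) → t ∉ Set.range (algebraMap K H) →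
        (∀ a : K, τ (algebraMap K H a) = algebraMap K H a) → τ t = -t →
        (∀ (σ : G) (a : K), (σ : H ≃ₐ[ℚ] H) (algebraMap K H a) = algebraMap K H a) →
        ((χ ⟨τ, hτG⟩ : ℂˣ) : ℂ) = -1 →
        ∃ DH : PAdicHeightDataK W p H,
          (∀ (σ : H ≃ₐ[ℚ] H) (a b : (W.baseChange H).toAffine.Point),
              DH.pairing (pointGalHom W H σ a) (pointGalHom W H σ b) = DH.pairing a b) ∧
          ChiLineGrossZagierClauses ι K W H f (ι (((unitRoot W p : ℚ_[p]) : PadicAlgCl p)))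
            (baseChangeDirichlet K ψ) 𝔭 𝔭' G χ DH ∧
          ∀ (Dc : PAdicHeightData (W.quadraticTwist (d : ℚ)) p), Dc.IsCanonicalSqMinusTwist →
            ∀ {X Y : ℚ} (hP : (W.quadraticTwist (d : ℚ)).toAffine.Nonsingular X Y) {x' y' : H}
              (hP' : (W.baseChange H).toAffine.Nonsingular x' y'),
              x' = algebraMap ℚ H (X / (d : ℚ)) →
                DH.pairing (.some x' y' hP') (.some x' y' hP') =
                  (c : ℚ_[p]) * Dc.pairing (.some X Y hP) (.some X Y hP) := by
  obtain ⟨c, hc, h⟩ := exists_datum_pinned hB hE hPin (p := p)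
  refine ⟨c, hc, ?_⟩
  intro ι K _ _ _ 𝔭 𝔭' W _ _ N _ f m _ ψ d _ H _ _ _ _ t τ G χ hτG hK hsplit h𝔭 h𝔭' hne hf hord hψ hmN
    hexc hexc' hΛ hKH ht2 htK hτK hτt hGK hχ
  -- `t² ∈ K`: `algebraMap ℚ H d = algebraMap K H d` for the integer `d`
  have hte : t ^ 2 = algebraMap K H (d : K) := by rw [ht2, map_intCast, map_intCast]
  have hG : ∀ σ : G, (σ : H ≃ₐ[ℚ] H) = 1 ∨ (σ : H ≃ₐ[ℚ] H) = τ :=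
    Literature.FieldTheory.Galois.QuadraticExtension.subgroup_eq_one_or_eq_of_fixing hKH htK hte hτK
      hτt hGK
  exact h ι K 𝔭 𝔭' W f ψ d H t τ G χ hτG hK hsplit h𝔭 h𝔭' hne hf hord hψ hmN hexc hexc' hΛ hKH ht2 htK
    hτK hτt hG hχ

end thmB_chi_quadraticBaseChange

end Literature.NumberTheory.EllipticCurves.Disegni2017

end
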